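import Mathlib
import HarnessLib
import Summits.HubbardSuperconductivity.HubbardSuperconductivity.Theorems.KLProgrammeKLRegimeVolumeLimitFlowFramesV17F2
import Summits.HubbardSuperconductivity.HubbardSuperconductivity.Theorems.KLProgrammeKLRegimeSplitGenericFrameMono
import Summits.HubbardSuperconductivity.HubbardSuperconductivity.Theorems.KLProgrammeKLRegimeSplitGenericV5

/-!
# K3 VL child, re-keyed binder («VL-R-WF2», pen (R223)(A1)): THE GEN-7-FLOW VL CHILD `VolumeLimitP3 klPredsV17F2 FinalTwoLegVolLimitEx klWindowC` FROM THE
# FLOW LINEAGE'S OWN-FRAME EXPORT STATED UNDER `R.WF2` (twin of `…VolumeLimitFlowFramesV17F2.volumeLimitTextV17F2_of_framedNestedFlowText`;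
# seat hubbard-kl-k3c4-p1 g16; PRESTAGE for skeleton «cauchy» v12)

The v11 skeleton's `_of` door `volumeLimitTextV17F2_of_framedNestedFlowText` turns the framed nested comparability text (binder `R.WF`) into `VolumeLimitP2`.  Its
`R.WF2` twin concludes the re-keyed child `VolumeLimitP3` (`…SplitGenericV5`).  Device: the V17F2 bundle with the frame class strengthened by `R.WF2`,
`{ klPredsV17F2 with frameOK := frameOK ∧ R.WF2 }` (inline; same four per-scale slots, so `HistP`/`TowerP` agree: `towerP_iff_of_slots`); for it the `R.WF`-keyed reduction chain of record
(`volumeLimitP2_of_perLabelThresholdsOnlyText`, generic in the bundle) applies — at a non-`WF2` package the strengthened class is EMPTY, so the `R.WF` text holds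
vacuously — and `VolumeLimitP2 ⟨device⟩ ⇒ VolumeLimitP3 klPredsV17F2` is one line (at a `WF2` package the two classes coincide).

* `towerP_klPredsV17F2_wf2_iff` (the device bundle `{ klPredsV17F2 with frameOK := frameOK ∧ R.WF2 }` is written INLINE — no definition in this file);
* `volumeLimitP3_of_volumeLimitP2W`;
* **`volumeLimitTextV17F3_of_framedNestedFlowText`** — `(the v11 two-volume text with binder R.WF2) → VolumeLimitP3 klPredsV17F2 FinalTwoLegVolLimitEx klWindowC`.

Honest framing: binder bookkeeping over landed reductions; nothing asserts the text, any stub, K3, VL or superconductivity.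
-/

noncomputable section

namespace Summit.HubbardSuperconductivity.HubbardSuperconductivity.Theorems.TwoPointAssembly

set_option linter.dupNamespace false -- summit = problem name (single-conjunct summit), D-0017

open Real Finset Filter Topology Literature.MathematicalPhysics.QuantumLattice Literature.Probability.LatticeModels
open Literature.MathematicalPhysics.QuantumLattice.FermiRG
open Summit.HubbardSuperconductivity.HubbardSuperconductivity.Theorems.DispersionFlow
open Summit.HubbardSuperconductivity.HubbardSuperconductivity.Theorems.KLRegimeSplit
open Summit.HubbardSuperconductivity.HubbardSuperconductivity.Theorems.KLProgrammeLegKernels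

/-- The device bundle `{ klPredsV17F2 with frameOK := frameOK ∧ R.WF2 }` (written inline — a proof device, no new definition) has the V17F2 tower
(the frame class is not read by `TowerP`). -/
theorem towerP_klPredsV17F2_wf2_iff (G : GeoConsts) (P : SplitConsts) (Q : EngConsts) (R : RenConsts) (β U μ : ℝ) (K : TrigPolyC4v) (Lstar : ℕ)
    (Mstar : ℕ → ℕ) : TowerP ({ klPredsV17F2 with frameOK := fun R U N μ K => klPredsV17F2.frameOK R U N μ K ∧ R.WF2 } : Preds) G P Q R β U μ K Lstar Mstar ↔
      TowerP klPredsV17F2 G P Q R β U μ K Lstar Mstar :=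
  towerP_iff_of_slots (Pr := klPredsV17F2) (Pr' := ({ klPredsV17F2 with frameOK := fun R U N μ K => klPredsV17F2.frameOK R U N μ K ∧ R.WF2 } : Preds)) rfl rfl rfl rfl G P Q R β U μ K Lstar Mstar

/-- **`VolumeLimitP2` for the device bundle gives `VolumeLimitP3` for V17F2** (at a `WF2` package the two frame classes coincide). -/
theorem volumeLimitP3_of_volumeLimitP2W {VL : VolLimitSlot} {W : Set ℝ}
    (h : VolumeLimitP2 ({ klPredsV17F2 with frameOK := fun R U N μ K => klPredsV17F2.frameOK R U N μ K ∧ R.WF2 } : Preds) VL W) :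
    VolumeLimitP3 klPredsV17F2 VL W := by
  intro G P Q R hG hP hQ hR2
  obtain ⟨c₅, hc₅, hc⟩ := h G P Q R hG hP hQ hR2.wf
  refine ⟨c₅, hc₅, fun c hc0 hcc => ?_⟩
  obtain ⟨U₀, hU₀, hmain⟩ := hc c hc0 hcc
  refine ⟨U₀, hU₀, fun μ hμ U hU hUle β hβ hβc K hK Lstar Mstar htower => ?_⟩
  exact hmain μ hμ U hU hUle β hβ hβc K ⟨hK, hR2⟩ Lstar Mstar ((towerP_klPredsV17F2_wf2_iff G P Q R β U μ K Lstar Mstar).2 htower)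

/-- **THE RE-KEYED VL CHILD FROM THE FLOW LINEAGE'S OWN-FRAME EXPORT UNDER `R.WF2`** (see the module docstring). -/
theorem volumeLimitTextV17F3_of_framedNestedFlowText
    (hS : ∀ (G : GeoConsts) (P : SplitConsts) (Q : EngConsts) (R : RenConsts), G.WF → P.WF → Q.WF → R.WF2 →
      ∃ c₅ : ℝ, 0 < c₅ ∧ ∀ c : ℝ, 0 < c → c ≤ c₅ → ∃ U₀ : ℝ, 0 < U₀ ∧
        ∀ μ ∈ klWindowC, ∀ U : ℝ, 0 < U → U ≤ U₀ → ∀ β : ℝ, klBetaMin ≤ β → β ≤ Real.exp (c / U ^ 2) →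
          ∀ K : TrigPolyC4v, klPredsV17F2.frameOK R U (nScales β) μ K →
            ∀ (Lstar : ℕ) (Mstar : ℕ → ℕ), TowerP klPredsV17F2 G P Q R β U μ K Lstar Mstar →
              ∀ n : ℤ, ∃ L₀ : ℕ, ∃ ρ : ℕ → ℝ, Tendsto ρ atTop (𝓝 0) ∧
                ∀ (L : ℕ) [NeZero L], L₀ ≤ L → ∀ (L'' : ℕ) [NeZero L''], L ∣ L'' → ∃ M₀ : ℕ, ∀ (M : ℕ) [NeZero M], M₀ ≤ M →
                  ∀ (ω : MatsubaraIdx M), matsubaraInt M ω = n → ∀ (k : TorusSite 2 L) (k'' : TorusSite 2 L''),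
                    latticeMomentum L'' k'' = latticeMomentum L k →
                      ‖klSelfEnergy L M β U μ (klFlowFrameU L M β U μ (nScales β + 1)) klE0 (nScales β + 1) (ω, k) 0 -
                          klSelfEnergy L'' M β U μ (klFlowFrameU L'' M β U μ (nScales β + 1)) klE0 (nScales β + 1) (ω, k'') 0‖ ≤ ρ L) :
    VolumeLimitP3 klPredsV17F2 FinalTwoLegVolLimitEx klWindowC := by
  refine volumeLimitP3_of_volumeLimitP2W ?_
  refine volumeLimitP2_of_perLabelThresholdsOnlyText
    ({ klPredsV17F2 with frameOK := fun R U N μ K => klPredsV17F2.frameOK R U N μ K ∧ R.WF2 } : Preds)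
    klWindowC (fun R U N μ K h => klPredsV17F2_frameOK_frameOK R U N μ K h.1) ?_
  intro G P Q R hG hP hQ hR
  by_cases hR2 : R.WF2
  · obtain ⟨c₅, hc₅, hc⟩ := hS G P Q R hG hP hQ hR2
    refine ⟨c₅, hc₅, fun c hc0 hcc => ?_⟩
    obtain ⟨U₀, hU₀, hU⟩ := hc c hc0 hcc
    refine ⟨U₀, hU₀, fun μ hμ U hU0 hUU β hβmin hβmax K hK Lstar Mstar hTW n => ?_⟩
    have hT : TowerP klPredsV17F2 G P Q R β U μ K Lstar Mstar := (towerP_klPredsV17F2_wf2_iff G P Q R β U μ K Lstar Mstar).1 hTW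
    have hβ : 0 < β := pos_of_klBetaMin_le hβmin
    have hSn := hU μ hμ U hU0 hUU β hβmin hβmax K hK.1 Lstar Mstar hT n
    refine perLabelBare_of_framedFlow_eventually hβ hU0.ne' μ n (fun L M _ _ => klFlowFrameU L M β U μ (nScales β + 1))
      (Kmax := max 0 (∑ m ∈ range (nScales β + 1), R.Gfr 0 * uPow 0 U * (4 : ℝ) ^ ((((0 : ℕ) : ℤ) - 2) * (m : ℤ)))) (le_max_left _ _) ?_ hSn ?_
    · refine ⟨Lstar, Mstar, fun L _ hL M _ hM q => ?_⟩
      exact (abs_eval_klFlowFrameU_le_of_towerV17F2 hT hL hM le_rfl q).trans (le_max_right _ _)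
    · refine ⟨Lstar, fun L => (∑ m ∈ range (nScales β + 1), Q.CL β m) / L, tendsto_const_div_atTop_nhds_zero_nat _,
        fun L _ hL L'' _ hdvd => ?_⟩
      have hLL'' : L ≤ L'' := Nat.le_of_dvd (Nat.pos_of_ne_zero (NeZero.ne L'')) hdvd
      refine ⟨max (max (Mstar L) (Mstar L'')) (max (Q.M0 β L) (Q.M0 β L'')), fun M _ hM k => ?_⟩
      exact flowFrames_twoVolume_of_towerV17F2 hμ hT hL hLL'' ((le_max_left _ _).trans ((le_max_left _ _).trans hM))
        ((le_max_left _ _).trans ((le_max_right _ _).trans hM)) ((le_max_right _ _).trans ((le_max_left _ _).trans hM))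
        ((le_max_right _ _).trans ((le_max_right _ _).trans hM)) le_rfl _
  · exact ⟨1, one_pos, fun c _ _ => ⟨1, one_pos, fun μ _ U _ _ β _ _ K hK => absurd hK.2 hR2⟩⟩

end Summit.HubbardSuperconductivity.HubbardSuperconductivity.Theorems.TwoPointAssembly

end
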